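import Literature.MathematicalPhysics.QuantumFieldTheory.Balaban1983to89.Beta.CompositionSingular
import Summits.QuantumFields.BalabanUV.Beta.FP.WellConditionedInverseLocality

/-!
# `BalabanUV.Beta.GAN24.EffectiveFormLocalisation` — binder row G-an2-4 ∕ (CONV-C), route R6 «VALUES, NOT DERIVATIVES», PART 105:
# S2′(h) — THE EFFECTIVE FORM AND THE HARD MINIMISER ARE AS LOCALISED AS THE SOFT RESOLVENT.  For a PSD fine form `H`, an averaging `Q`
# onto the unit lattice, `a > 0` and the regularised form `K = H + Qᵀ(a•1)Q` (Bałaban's `Δ_a = Δ + Q*aQ`): if `K` is coercive, the constrained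
# problem has a k-uniform UPPER BOUND `Λ` (one trial field per unit datum), and the unit-lattice block propagator `P = Q K⁻¹ Qᵀ` decays like
# `c₀e^{−δ₀ρ}`, then `𝒮 := effForm H Q = P⁻¹ − a•1` obeys `|𝒮(b,b′)| ≤ (2(Λ+a) + a)·e^{−δ′ρ(b,b′)}` and the hard minimiser `ℋ = minOp H Q = K⁻¹QᵀP⁻¹`
# has columns `|ℋ(x,b)| ≤ 2(Λ+a)·c₁·Kf(m∕2)·e^{−(m∕2)σ(x,b)}`, with `δ′ = B4Sect5Torus.rate Kf (Λ+a)⁻¹ c₀ δ₀` EXPLICIT and VOLUME-FREE; and `P`'s ∕ `K⁻¹Qᵀ`'s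
# decay letters follow from ONE fine-lattice input — entry decay of the SOFT resolvent `K⁻¹` — plus the block locality of `Q`
# (unit b2b-balaban-gan24-p3, gen 50; v1)

NOT IN PRINT; OUR PROOF (for the ROUTE; [folklore] finite-dimensional linear algebra BY NAME over tree theorems: the an2 lineage's regularised reading of the
bordered inverse `CompositionSingular.blocks_eq_of_reg` (`𝒮 = P_K⁻¹ − A`, `ℋ = K⁻¹QᵀP_K⁻¹`, [B9] (3.126) ∕ (3.156) pattern) and the finite
Combes–Thomas ∕ [B4] Sect. 5 mechanism «a well-conditioned, exponentially localised symmetric kernel has an exponentially localised inverse, constants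
independent of the volume» kernel-proved in the tree as `B4Sect5Torus.inv_decay` and packaged as `FP.WellConditionedInverseLocality.abs_inv_le_of_coercive_localised`
(t4-ne9-formalise-leaf-04) — the Demko–Moss–Smith ∕ Jaffard step that ROUTES-GAN24 «R6 — v64 ∕ v65 NOTE» (LENS 21 (C), clause S2′(h)) names as the printed tool
[Jaffard, Ann. IHP Anal. Non Linéaire 7 (1990) 461–476, Prop. 2 p. 464 — METHOD reference only; nothing of it is cited as a hypothesis]).
HONEST FRAMING (cell contract, verbatim): «discharging `BetaPertH` makes Bałaban's UV stability UNCONDITIONAL — a real constructive-QFT result; it is NOT the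
continuum limit and NOT the Clay problem.»  HONEST DEPENDENCY (verbatim): «continuum YM on T⁴ ⇐ BetaPertH ∧ nine spine estimates (0/9 proved); BetaPertH ⇐
(D1) ∧ (D4) ∧ CAP+tail; G-an2-4 gates asym, D1 and NE2/3/4.»

WHY THIS FILE.  Route R6's scheduled END (PARTs 88 ∕ 90 ∕ 96, `gen47/R6-SCHEDULE-NOTE.md` §4, `gen48/R6-LEDGER-NOTE.md` §2) lists among its UNTYPED inputs the
k-uniform COLUMN PROFILE of the hard minimiser `ℋ_j` («(H2)-class, [CMP 99-bg] Thm 3.1 (3.42)–(3.47) WITH background»), and (CONV-C) itself is «[k-uniform DECAY]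
∧ [geometric RATE]» (ROUTES-GAN24 §2 R7), the decay half for the effective-form constituent `𝒮_k = CᵀΔ^{(k)}C` being the same (H2)-class item.  The
idea seat's LENS 21 (C) ∕ LENS 22 («R6 — v64 NOTE», «R6 — v65 NOTE (3)») located the reduction S2′(h): `ℋ = K⁻¹Qᵀ(QK⁻¹Qᵀ)⁻¹` with `K = H + aQᵀQ`; the
unit-lattice operator `QK⁻¹Qᵀ` is WELL-CONDITIONED given the upper bound (`a⁻¹ ≥ QK⁻¹Qᵀ ≥ (‖𝒮‖ + a)⁻¹`) and exponentially localised, hence so is its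
inverse — «folklore S (Demko–Moss–Smith ∕ Jaffard type)», «unprinted verification» in the desk's list (PRICING-GAN24 v3.94 R6 l.787: «the unprinted
verifications S2(b′) ∕ S2′(h) ∕ S2-B♭ ∕ the composition lemma»).  THIS FILE TYPES S2′(h): after it, BOTH the decay half of (CONV-C) for `𝒮_k` and the
column profile of `ℋ_k` — with background or without — follow from ONE fine-lattice letter, the (3.42)-SHAPE entry decay of the SOFT resolvent
`G_k = (Δ + Q_k*aQ_k)⁻¹` in UNIT-scale distance, plus the upper bound `Λ` and the block locality of `Q_k`, with constants that see neither `k` nor the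
volume.  (Tree holders of the soft letter, by lane: `U = 1` — `Beta.DeltaACombesThomas` ∕ road P1's `GAN24.CombesThomas*`; with background at MODEL level —
beta-d4-p2's `Beta.CovariantTowerDecayCT.entry_le_tower`, t4-ne9-p1's `B9Eq326LocalPartBlockDecayClosed`; for Bałaban's own `G_k(U)` it is [B9] Thm 3.1 —
PRINTED, not instantiated here.)

WHAT THIS FILE PROVES (0 sorry, 0 `def`, nothing cited; real matrices; `c` = unit index set with a pseudo-distance `ρ` and lattice-sum profile `Kf`
(`B4Sect5Torus.IsPseudoDist ∕ SumBound`), `ν` = fine index set):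
* §1 the regularised form `K = H + Qᵀ(a•1)Q`: `transpose_reg` (symmetric), `form_reg` (`⟨u,Ku⟩ = ⟨u,Hu⟩ + a|Qu|²`), `isUnit_det_of_coercive`;
  `isSymm_blockProp` (`P = QK⁻¹Qᵀ` symmetric); **`blockProp_coercive_of_ub`** — THE CONDITIONING: `H` PSD, `a > 0`, `K` coercive, and the UPPER BOUND in
  trial form `∀ B, ∃ u, Qu = B ∧ ⟨u,Hu⟩ ≤ Λ|B|²` ⟹ `(Λ + a)⁻¹|B|² ≤ ⟨B, PB⟩` (one completed square: `⟨QᵀB,K⁻¹QᵀB⟩ ≥ 2t⟨B,Qu⟩ − t²⟨u,Ku⟩` at `t = (Λ+a)⁻¹`).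
* §2 **`abs_effForm_add_le`** ∕ **`abs_effForm_le`** — THE EFFECTIVE FORM IS LOCALISED: with `|P(b,b′)| ≤ c₀e^{−δ₀ρ(b,b′)}`,
  `|(𝒮 + a•1)(b,b′)| = |P⁻¹(b,b′)| ≤ 2(Λ+a)·e^{−δ′ρ(b,b′)}` and `|𝒮(b,b′)| ≤ (2(Λ+a) + a)·e^{−δ′ρ(b,b′)}`, `δ′ = rate Kf (Λ+a)⁻¹ c₀ δ₀ > 0`.
* §3 **`abs_minOp_le`** — THE HARD MINIMISER'S COLUMNS ARE LOCALISED: with a fine-to-unit gauge `σ : ν → c → ℝ`, `0 ≤ σ`, compatible with `ρ`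
  (`σ(x,b) ≤ σ(x,b′) + ρ(b′,b)`) and `|(K⁻¹Qᵀ)(x,b′)| ≤ c₁e^{−δ₁σ(x,b′)}`: `|ℋ(x,b)| ≤ 2(Λ+a)·c₁·Kf(m∕2)·e^{−(m∕2)σ(x,b)}`, `m = min δ₁ δ′`.
* §4 THE TWO LETTERS FROM THE SOFT RESOLVENT: `abs_blockProp_le_of_resolvent` (`|K⁻¹(x,x′)| ≤ Ce^{−δD(x,x′)}`, row mass `Σ_x|Q(b,x)| ≤ q₁`, block
  compatibility `Q(b,x) ≠ 0 → Q(b′,x′) ≠ 0 → ρ(b,b′) ≤ D(x,x′) + R` ⟹ `|P(b,b′)| ≤ q₁²Ce^{δR}·e^{−δρ(b,b′)}`) and `abs_inv_mul_transpose_le_of_resolvent`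
  (`Q(b′,x′) ≠ 0 → σ(x,b′) ≤ D(x,x′) + R′` ⟹ `|(K⁻¹Qᵀ)(x,b′)| ≤ q₁Ce^{δR′}·e^{−δσ(x,b′)}`).
WHAT IT DOES NOT DO: supply the soft letter for Bałaban's `G_k(U)` (that is [B9] Thm 3.1, printed, or the model-level tree files named above — not instantiated here);
touch the RATE half of (CONV-C); choose `ρ`, `σ`, `D` for a lattice (the unit torus with its sup-distance and `Kf a = N·latticeConst d a` is the instance of record,
`B4Sect5Torus.trho_isPseudoDist ∕ trho_sumBound`).  SUPPLIER work on route C-R6° (rank 2, REDUCTION); no consumer of record; NEVER «G-an2-4 closed»; NOT (CONV-C),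
NOT D1, NOT `BetaPertH`, NOT continuum, NOT Clay.  Records: `HOME/b2b-balaban-gan24-p3/gen50/README.md`.
-/

noncomputable section

open scoped BigOperators Matrix
open Finset Matrix
open Literature.MathematicalPhysics.QuantumFieldTheory.Balaban1983to89
open Literature.MathematicalPhysics.QuantumFieldTheory.Balaban1983to89.B4Sect5Torus (IsPseudoDist SumBound rate rate_pos)
open Literature.MathematicalPhysics.QuantumFieldTheory.Balaban1983to89.Beta.Composition (kkt blockProp)
open Literature.MathematicalPhysics.QuantumFieldTheory.Balaban1983to89.Beta.CompositionSingular (effForm minOp blocks_eq_of_reg effForm_eq_of_reg)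
open Summit.QuantumFields.BalabanUV.Beta.FP.WellConditionedInverseLocality (abs_inv_le_of_coercive_localised)

namespace Summit.QuantumFields.BalabanUV.Beta.GAN24.EffectiveFormLocalisation

variable {c ν : Type*} [Fintype c] [Fintype ν] [DecidableEq c] [DecidableEq ν]
variable {H : Matrix ν ν ℝ} {Q : Matrix c ν ℝ} {a : ℝ}

/-! ## §1 The regularised form `K = H + Qᵀ(a•1)Q` and the conditioning of `P = Q K⁻¹ Qᵀ` -/

omit [Fintype ν] [DecidableEq ν] in
/-- `Qᵀ(a•1)Q = a•(QᵀQ)`. [folklore] -/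
theorem transpose_mul_smul_one_mul (Q : Matrix c ν ℝ) (a : ℝ) :
    Qᵀ * (a • (1 : Matrix c c ℝ)) * Q = a • (Qᵀ * Q) := by
  rw [Matrix.mul_smul, Matrix.mul_one, Matrix.smul_mul]

omit [Fintype ν] [DecidableEq ν] in
/-- the regularised form is symmetric when `H` is. [folklore] -/
theorem transpose_reg (hH : Hᵀ = H) (a : ℝ) : (H + Qᵀ * (a • (1 : Matrix c c ℝ)) * Q)ᵀ = H + Qᵀ * (a • (1 : Matrix c c ℝ)) * Q := by
  rw [transpose_mul_smul_one_mul, transpose_add, hH, transpose_smul, transpose_mul, transpose_transpose]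

omit [DecidableEq ν] in
/-- the quadratic form of the regularised form: `⟨u,Ku⟩ = ⟨u,Hu⟩ + a·|Qu|²` (Bałaban's (3.111): the `a`-term is `a|B|²` on the fibre `Qu = B`). [folklore] -/
theorem form_reg (u : ν → ℝ) (a : ℝ) :
    u ⬝ᵥ ((H + Qᵀ * (a • (1 : Matrix c c ℝ)) * Q) *ᵥ u) = u ⬝ᵥ (H *ᵥ u) + a * ((Q *ᵥ u) ⬝ᵥ (Q *ᵥ u)) := by
  rw [transpose_mul_smul_one_mul, add_mulVec, dotProduct_add, smul_mulVec, dotProduct_smul, ← mulVec_mulVec,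
    dotProduct_mulVec u Qᵀ, vecMul_transpose, smul_eq_mul]

omit [DecidableEq ν] in
/-- a coercive matrix (`γ|x|² ≤ ⟨x,Sx⟩`, `γ > 0`) has a unit determinant. [folklore] -/
theorem isUnit_det_of_coercive {S : Matrix c c ℝ} {γ : ℝ} (hγ : 0 < γ) (h : QGQInverse.Coercive S γ) : IsUnit S.det :=
  (Matrix.isUnit_iff_isUnit_det S).mp (QGQInverse.isUnit_of_coercive hγ h)

/-- a coercive fine matrix has a unit determinant (the same lemma on the fine index set). [folklore] -/
theorem isUnit_det_of_coercive_fine {K : Matrix ν ν ℝ} {γ : ℝ} (hγ : 0 < γ) (h : QGQInverse.Coercive K γ) : IsUnit K.det :=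
  (Matrix.isUnit_iff_isUnit_det K).mp (QGQInverse.isUnit_of_coercive hγ h)

omit [Fintype c] [DecidableEq c] in
/-- the block propagator `P = Q K⁻¹ Qᵀ` of a symmetric `K` is symmetric. [folklore] -/
theorem isSymm_blockProp {K : Matrix ν ν ℝ} (hK : Kᵀ = K) : (blockProp K Q).IsSymm := by
  unfold Matrix.IsSymm blockProp
  rw [transpose_mul, transpose_mul, transpose_transpose, transpose_nonsing_inv, hK, Matrix.mul_assoc]

omit [Fintype c] [DecidableEq c] [DecidableEq ν] in
/-- **COMPLETING THE SQUARE**: for a symmetric invertible `K` with nonnegative form and `Kv = w`: `2t⟨u,w⟩ − t²⟨u,Ku⟩ ≤ ⟨v,w⟩` for every `u`, `t`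
(`0 ≤ ⟨v − tu, K(v − tu)⟩`). [folklore] -/
theorem two_mul_sub_sq_mul_le {K : Matrix ν ν ℝ} (hK : Kᵀ = K) (hpsd : ∀ z : ν → ℝ, 0 ≤ z ⬝ᵥ (K *ᵥ z)) {v w : ν → ℝ} (hv : K *ᵥ v = w)
    (u : ν → ℝ) (t : ℝ) : 2 * t * (u ⬝ᵥ w) - t ^ 2 * (u ⬝ᵥ (K *ᵥ u)) ≤ v ⬝ᵥ w := by
  have h0 := hpsd (v - t • u)
  have hsym : ∀ x y : ν → ℝ, x ⬝ᵥ (K *ᵥ y) = y ⬝ᵥ (K *ᵥ x) := fun x y => by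
    rw [dotProduct_mulVec, dotProduct_comm, ← mulVec_transpose, hK]
  rw [mulVec_sub, mulVec_smul, sub_dotProduct, dotProduct_sub, dotProduct_sub, hv, dotProduct_smul, smul_dotProduct, smul_dotProduct,
    dotProduct_smul] at h0
  have e1 : v ⬝ᵥ (K *ᵥ u) = u ⬝ᵥ w := by rw [hsym, hv]
  simp only [smul_eq_mul] at h0
  rw [e1] at h0
  nlinarith [h0]

/-- **`blockProp_coercive_of_ub` — THE CONDITIONING OF THE UNIT-LATTICE BLOCK PROPAGATOR** [our proof]: `H` symmetric with nonnegative form, `a > 0`,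
`K = H + Qᵀ(a•1)Q` coercive (`γ > 0`, only for invertibility), and the UPPER BOUND of the constrained problem in trial form (`∀ B, ∃ u, Qu = B ∧
⟨u,Hu⟩ ≤ Λ|B|²`, `0 ≤ Λ`) ⟹ `(Λ + a)⁻¹·|B|² ≤ ⟨B, QK⁻¹QᵀB⟩` for every `B` — i.e. `QGQInverse.Coercive (blockProp K Q) (Λ + a)⁻¹`.
(`⟨B,PB⟩ = ⟨v, QᵀB⟩`, `v = K⁻¹QᵀB`; complete the square against the trial field `u`: `⟨u,QᵀB⟩ = |B|²`, `⟨u,Ku⟩ ≤ (Λ+a)|B|²`, `t = (Λ+a)⁻¹`.) -/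
theorem blockProp_coercive_of_ub (hH : Hᵀ = H) (hpsd : ∀ z : ν → ℝ, 0 ≤ z ⬝ᵥ (H *ᵥ z)) (ha : 0 < a) {γ : ℝ} (hγ : 0 < γ)
    (hK : QGQInverse.Coercive (H + Qᵀ * (a • (1 : Matrix c c ℝ)) * Q) γ) {Λ : ℝ} (hΛ : 0 ≤ Λ)
    (hUB : ∀ B : c → ℝ, ∃ u : ν → ℝ, Q *ᵥ u = B ∧ u ⬝ᵥ (H *ᵥ u) ≤ Λ * (B ⬝ᵥ B)) :
    QGQInverse.Coercive (blockProp (H + Qᵀ * (a • (1 : Matrix c c ℝ)) * Q) Q) (Λ + a)⁻¹ := by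
  set K : Matrix ν ν ℝ := H + Qᵀ * (a • (1 : Matrix c c ℝ)) * Q with hKdef
  have hKsym : Kᵀ = K := transpose_reg hH a
  have hKpsd : ∀ z : ν → ℝ, 0 ≤ z ⬝ᵥ (K *ᵥ z) := fun z => by
    rw [hKdef, form_reg]
    have h1 := hpsd z
    have h2 : 0 ≤ (Q *ᵥ z) ⬝ᵥ (Q *ᵥ z) := by rw [dotProduct]; exact Finset.sum_nonneg fun i _ => mul_self_nonneg _
    positivity
  have hKdet : IsUnit K.det := isUnit_det_of_coercive_fine hγ hK
  intro B
  obtain ⟨u, huB, huH⟩ := hUB B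
  have hΛa : 0 < Λ + a := by linarith
  -- `v = K⁻¹QᵀB`, `Kv = QᵀB`
  set w : ν → ℝ := Qᵀ *ᵥ B with hw
  set v : ν → ℝ := K⁻¹ *ᵥ w with hv
  have hKv : K *ᵥ v = w := by rw [hv, mulVec_mulVec, mul_nonsing_inv _ hKdet, one_mulVec]
  -- `⟨B, PB⟩ = ⟨v, w⟩`
  have hP : B ⬝ᵥ (blockProp K Q *ᵥ B) = v ⬝ᵥ w := by
    rw [blockProp, Matrix.mul_assoc, ← mulVec_mulVec, ← mulVec_mulVec, ← hw, ← hv, dotProduct_mulVec, ← mulVec_transpose, ← hw,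
      dotProduct_comm]
  -- the trial field's letters: `⟨u, w⟩ = |B|²`, `⟨u, Ku⟩ ≤ (Λ + a)|B|²`
  have huw : u ⬝ᵥ w = B ⬝ᵥ B := by
    rw [hw, dotProduct_mulVec, vecMul_transpose, huB]
  have huK : u ⬝ᵥ (K *ᵥ u) ≤ (Λ + a) * (B ⬝ᵥ B) := by
    rw [hKdef, form_reg, huB, add_mul]
    linarith
  have hsq := two_mul_sub_sq_mul_le hKsym hKpsd hKv u (Λ + a)⁻¹
  rw [huw] at hsq
  rw [hP]
  have hBB : 0 ≤ B ⬝ᵥ B := by rw [dotProduct]; exact Finset.sum_nonneg fun i _ => mul_self_nonneg _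
  have hinv : (Λ + a)⁻¹ * (Λ + a) = 1 := inv_mul_cancel₀ hΛa.ne'
  have h3 : (Λ + a)⁻¹ ^ 2 * (u ⬝ᵥ (K *ᵥ u)) ≤ (Λ + a)⁻¹ * (B ⬝ᵥ B) := by
    calc (Λ + a)⁻¹ ^ 2 * (u ⬝ᵥ (K *ᵥ u)) ≤ (Λ + a)⁻¹ ^ 2 * ((Λ + a) * (B ⬝ᵥ B)) :=
          mul_le_mul_of_nonneg_left huK (by positivity)
      _ = (Λ + a)⁻¹ * (B ⬝ᵥ B) := by rw [pow_two, mul_assoc, ← mul_assoc (Λ + a)⁻¹ (Λ + a), hinv, one_mul]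
  linarith

/-! ## §2 The effective form is localised -/

section EffForm

variable {ρ : c → c → ℝ} {Kf : ℝ → ℝ}

/-- **`abs_effForm_add_le` — THE REGULARISED EFFECTIVE FORM `𝒮 + a•1 = (QK⁻¹Qᵀ)⁻¹` IS LOCALISED** [our proof; `blocks_eq_of_reg` + `abs_inv_le_of_coercive_localised`
BY NAME]: under §1's hypotheses and the DISPLAYED unit-lattice decay `|(QK⁻¹Qᵀ)(b,b′)| ≤ c₀e^{−δ₀ρ(b,b′)}` (`c₀ ≥ 0`, `δ₀ > 0`; `ρ` a pseudo-distance with profile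
`Kf`): `|(effForm H Q + a•1)(b,b′)| ≤ 2(Λ+a)·e^{−rate Kf (Λ+a)⁻¹ c₀ δ₀ · ρ(b,b′)}` — constants independent of the fine index set (k- and volume-uniform). -/
theorem abs_effForm_add_le (hKf : ∀ r, 0 < r → 0 ≤ Kf r) (hρ : IsPseudoDist ρ) (hS : SumBound ρ Kf)
    (hH : Hᵀ = H) (hpsd : ∀ z : ν → ℝ, 0 ≤ z ⬝ᵥ (H *ᵥ z)) (ha : 0 < a) {γ : ℝ} (hγ : 0 < γ)
    (hK : QGQInverse.Coercive (H + Qᵀ * (a • (1 : Matrix c c ℝ)) * Q) γ) {Λ : ℝ} (hΛ : 0 ≤ Λ)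
    (hUB : ∀ B : c → ℝ, ∃ u : ν → ℝ, Q *ᵥ u = B ∧ u ⬝ᵥ (H *ᵥ u) ≤ Λ * (B ⬝ᵥ B)) {c₀ δ₀ : ℝ} (hc₀ : 0 ≤ c₀) (hδ₀ : 0 < δ₀)
    (hP : ∀ b b', |blockProp (H + Qᵀ * (a • (1 : Matrix c c ℝ)) * Q) Q b b'| ≤ c₀ * Real.exp (-(δ₀ * ρ b b'))) (b b' : c) :
    |(effForm H Q + a • (1 : Matrix c c ℝ)) b b'| ≤ 2 * (Λ + a) * Real.exp (-(rate Kf (Λ + a)⁻¹ c₀ δ₀ * ρ b b')) := by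
  set K : Matrix ν ν ℝ := H + Qᵀ * (a • (1 : Matrix c c ℝ)) * Q with hKdef
  have hΛa : 0 < Λ + a := by linarith
  have hPco : QGQInverse.Coercive (blockProp K Q) (Λ + a)⁻¹ := blockProp_coercive_of_ub hH hpsd ha hγ hK hΛ hUB
  have hKdet : IsUnit K.det := isUnit_det_of_coercive_fine hγ hK
  have hPdet : IsUnit (blockProp K Q).det := isUnit_det_of_coercive (inv_pos.mpr hΛa) hPco
  have hE : effForm H Q + a • (1 : Matrix c c ℝ) = (blockProp K Q)⁻¹ := by
    rw [effForm_eq_of_reg H Q (a • (1 : Matrix c c ℝ)) hKdet hPdet, sub_add_cancel]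
  rw [hE]
  have h := abs_inv_le_of_coercive_localised hKf hρ hS (isSymm_blockProp (transpose_reg hH a)) (inv_pos.mpr hΛa) hc₀ hδ₀ hPco hP b b'
  rwa [div_inv_eq_mul] at h

/-- **`abs_effForm_le` — THE EFFECTIVE FORM `𝒮 = effForm H Q` IS LOCALISED** [our proof]: same hypotheses ⟹
`|𝒮(b,b′)| ≤ (2(Λ+a) + a)·e^{−rate Kf (Λ+a)⁻¹ c₀ δ₀ · ρ(b,b′)}` (the `a•1` costs `a` on the diagonal, where `ρ = 0`). The k-uniform DECAY HALF of (CONV-C) for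
the effective-form constituent, reduced to the soft resolvent's decay + the upper bound. -/
theorem abs_effForm_le (hKf : ∀ r, 0 < r → 0 ≤ Kf r) (hρ : IsPseudoDist ρ) (hS : SumBound ρ Kf)
    (hH : Hᵀ = H) (hpsd : ∀ z : ν → ℝ, 0 ≤ z ⬝ᵥ (H *ᵥ z)) (ha : 0 < a) {γ : ℝ} (hγ : 0 < γ)
    (hK : QGQInverse.Coercive (H + Qᵀ * (a • (1 : Matrix c c ℝ)) * Q) γ) {Λ : ℝ} (hΛ : 0 ≤ Λ)
    (hUB : ∀ B : c → ℝ, ∃ u : ν → ℝ, Q *ᵥ u = B ∧ u ⬝ᵥ (H *ᵥ u) ≤ Λ * (B ⬝ᵥ B)) {c₀ δ₀ : ℝ} (hc₀ : 0 ≤ c₀) (hδ₀ : 0 < δ₀)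
    (hP : ∀ b b', |blockProp (H + Qᵀ * (a • (1 : Matrix c c ℝ)) * Q) Q b b'| ≤ c₀ * Real.exp (-(δ₀ * ρ b b'))) (b b' : c) :
    |effForm H Q b b'| ≤ (2 * (Λ + a) + a) * Real.exp (-(rate Kf (Λ + a)⁻¹ c₀ δ₀ * ρ b b')) := by
  have h := abs_effForm_add_le hKf hρ hS hH hpsd ha hγ hK hΛ hUB hc₀ hδ₀ hP b b'
  set r : ℝ := rate Kf (Λ + a)⁻¹ c₀ δ₀ with hr
  have hexp : 0 ≤ Real.exp (-(r * ρ b b')) := (Real.exp_pos _).le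
  -- the diagonal shift: `|a·[b = b′]| ≤ a·e^{−rρ(b,b′)}` since `ρ(b,b) = 0`
  have hdiag : |(a • (1 : Matrix c c ℝ)) b b'| ≤ a * Real.exp (-(r * ρ b b')) := by
    rw [Matrix.smul_apply, smul_eq_mul]
    by_cases hbb : b = b'
    · subst hbb
      rw [one_apply_eq, mul_one, hρ.zero, mul_zero, neg_zero, Real.exp_zero, mul_one, abs_of_pos ha]
    · rw [one_apply_ne hbb, mul_zero, abs_zero]; positivity
  have hsplit : effForm H Q b b' = (effForm H Q + a • (1 : Matrix c c ℝ)) b b' - (a • (1 : Matrix c c ℝ)) b b' := by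
    rw [Matrix.add_apply, add_sub_cancel_right]
  rw [hsplit]
  calc |(effForm H Q + a • (1 : Matrix c c ℝ)) b b' - (a • (1 : Matrix c c ℝ)) b b'|
      ≤ |(effForm H Q + a • (1 : Matrix c c ℝ)) b b'| + |(a • (1 : Matrix c c ℝ)) b b'| := abs_sub _ _
    _ ≤ 2 * (Λ + a) * Real.exp (-(r * ρ b b')) + a * Real.exp (-(r * ρ b b')) := add_le_add h hdiag
    _ = (2 * (Λ + a) + a) * Real.exp (-(r * ρ b b')) := by ring

end EffForm

/-! ## §3 The hard minimiser's columns are localised -/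

section MinOp

variable {ρ : c → c → ℝ} {Kf : ℝ → ℝ} {σ : ν → c → ℝ}

omit [Fintype ν] [DecidableEq c] [DecidableEq ν] in
/-- **CONVOLUTION OF TWO EXPONENTIAL PROFILES** (fine-to-unit × unit-to-unit): `0 ≤ σ`, `σ(x,b) ≤ σ(x,b′) + ρ(b′,b)`, `ρ` a pseudo-distance with profile `Kf`,
`0 < m ≤ δ₁`, `m ≤ δ₂` ⟹ `Σ_{b′} e^{−δ₁σ(x,b′)}·e^{−δ₂ρ(b′,b)} ≤ Kf(m∕2)·e^{−(m∕2)σ(x,b)}`. [folklore] -/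
theorem sum_exp_mul_exp_le (hρ : IsPseudoDist ρ) (hS : SumBound ρ Kf) (hσ0 : ∀ x b, 0 ≤ σ x b)
    (hσρ : ∀ x b b', σ x b ≤ σ x b' + ρ b' b) {δ₁ δ₂ m : ℝ} (hm : 0 < m) (hm₁ : m ≤ δ₁) (hm₂ : m ≤ δ₂) (x : ν) (b : c) :
    ∑ b', Real.exp (-(δ₁ * σ x b')) * Real.exp (-(δ₂ * ρ b' b)) ≤ Kf (m / 2) * Real.exp (-(m / 2 * σ x b)) := by
  have hpt : ∀ b', Real.exp (-(δ₁ * σ x b')) * Real.exp (-(δ₂ * ρ b' b)) ≤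
      Real.exp (-(m / 2 * σ x b)) * Real.exp (-(m / 2 * ρ b b')) := fun b' => by
    rw [← Real.exp_add, ← Real.exp_add]
    apply Real.exp_le_exp.mpr
    have h1 : m * σ x b' ≤ δ₁ * σ x b' := mul_le_mul_of_nonneg_right hm₁ (hσ0 x b')
    have h2 : m * ρ b' b ≤ δ₂ * ρ b' b := mul_le_mul_of_nonneg_right hm₂ (hρ.nonneg b' b)
    have h3 := hσρ x b b'
    have h4 := hσ0 x b'
    rw [hρ.symm b b']
    nlinarith
  calc ∑ b', Real.exp (-(δ₁ * σ x b')) * Real.exp (-(δ₂ * ρ b' b))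
      ≤ ∑ b', Real.exp (-(m / 2 * σ x b)) * Real.exp (-(m / 2 * ρ b b')) := Finset.sum_le_sum fun b' _ => hpt b'
    _ = Real.exp (-(m / 2 * σ x b)) * ∑ b', Real.exp (-(m / 2 * ρ b b')) := by rw [Finset.mul_sum]
    _ ≤ Real.exp (-(m / 2 * σ x b)) * Kf (m / 2) := mul_le_mul_of_nonneg_left (hS _ (by linarith) b) (Real.exp_pos _).le
    _ = Kf (m / 2) * Real.exp (-(m / 2 * σ x b)) := mul_comm _ _

/-- **`abs_minOp_le` — THE HARD MINIMISER `ℋ = minOp H Q = K⁻¹Qᵀ(QK⁻¹Qᵀ)⁻¹` HAS LOCALISED COLUMNS** [our proof; `blocks_eq_of_reg` + §2 BY NAME]: under §2's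
hypotheses, a fine-to-unit gauge `σ ≥ 0` compatible with `ρ` and the DISPLAYED decay `|(K⁻¹Qᵀ)(x,b′)| ≤ c₁e^{−δ₁σ(x,b′)}` (`c₁ ≥ 0`, `δ₁ > 0`):
`|ℋ(x,b)| ≤ 2(Λ+a)·c₁·Kf(m∕2)·e^{−(m∕2)σ(x,b)}`, `m = min δ₁ (rate Kf (Λ+a)⁻¹ c₀ δ₀)` — the k-uniform column profile (R6-SCHEDULE-NOTE §4's «(H2)-class» row)
reduced to the soft resolvent's decay + the upper bound. -/
theorem abs_minOp_le (hKf : ∀ r, 0 < r → 0 ≤ Kf r) (hρ : IsPseudoDist ρ) (hS : SumBound ρ Kf)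
    (hH : Hᵀ = H) (hpsd : ∀ z : ν → ℝ, 0 ≤ z ⬝ᵥ (H *ᵥ z)) (ha : 0 < a) {γ : ℝ} (hγ : 0 < γ)
    (hK : QGQInverse.Coercive (H + Qᵀ * (a • (1 : Matrix c c ℝ)) * Q) γ) {Λ : ℝ} (hΛ : 0 ≤ Λ)
    (hUB : ∀ B : c → ℝ, ∃ u : ν → ℝ, Q *ᵥ u = B ∧ u ⬝ᵥ (H *ᵥ u) ≤ Λ * (B ⬝ᵥ B)) {c₀ δ₀ : ℝ} (hc₀ : 0 ≤ c₀) (hδ₀ : 0 < δ₀)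
    (hP : ∀ b b', |blockProp (H + Qᵀ * (a • (1 : Matrix c c ℝ)) * Q) Q b b'| ≤ c₀ * Real.exp (-(δ₀ * ρ b b')))
    (hσ0 : ∀ x b, 0 ≤ σ x b) (hσρ : ∀ x b b', σ x b ≤ σ x b' + ρ b' b) {c₁ δ₁ : ℝ} (hc₁ : 0 ≤ c₁) (hδ₁ : 0 < δ₁)
    (hKQ : ∀ x b', |((H + Qᵀ * (a • (1 : Matrix c c ℝ)) * Q)⁻¹ * Qᵀ) x b'| ≤ c₁ * Real.exp (-(δ₁ * σ x b'))) (x : ν) (b : c) :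
    |minOp H Q x b| ≤ 2 * (Λ + a) * c₁ * Kf (min δ₁ (rate Kf (Λ + a)⁻¹ c₀ δ₀) / 2) *
      Real.exp (-(min δ₁ (rate Kf (Λ + a)⁻¹ c₀ δ₀) / 2 * σ x b)) := by
  set K : Matrix ν ν ℝ := H + Qᵀ * (a • (1 : Matrix c c ℝ)) * Q with hKdef
  set r : ℝ := rate Kf (Λ + a)⁻¹ c₀ δ₀ with hr
  have hΛa : 0 < Λ + a := by linarith
  have hPco : QGQInverse.Coercive (blockProp K Q) (Λ + a)⁻¹ := blockProp_coercive_of_ub hH hpsd ha hγ hK hΛ hUB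
  have hKdet : IsUnit K.det := isUnit_det_of_coercive_fine hγ hK
  have hPdet : IsUnit (blockProp K Q).det := isUnit_det_of_coercive (inv_pos.mpr hΛa) hPco
  have hrpos : 0 < r := rate_pos hKf (inv_pos.mpr hΛa) hc₀ hδ₀
  set m : ℝ := min δ₁ r with hm
  have hmpos : 0 < m := lt_min hδ₁ hrpos
  -- `ℋ = (K⁻¹Qᵀ)·P⁻¹`, entrywise
  have hM : minOp H Q = K⁻¹ * Qᵀ * (blockProp K Q)⁻¹ := (blocks_eq_of_reg H Q (a • (1 : Matrix c c ℝ)) hKdet hPdet).2.1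
  have hPinv : ∀ b' : c, |(blockProp K Q)⁻¹ b' b| ≤ 2 * (Λ + a) * Real.exp (-(r * ρ b' b)) := fun b' => by
    have h := abs_inv_le_of_coercive_localised hKf hρ hS (isSymm_blockProp (transpose_reg hH a)) (inv_pos.mpr hΛa) hc₀ hδ₀ hPco hP b' b
    rwa [div_inv_eq_mul] at h
  rw [hM, Matrix.mul_apply]
  calc |∑ b', (K⁻¹ * Qᵀ) x b' * (blockProp K Q)⁻¹ b' b|
      ≤ ∑ b', |(K⁻¹ * Qᵀ) x b' * (blockProp K Q)⁻¹ b' b| := Finset.abs_sum_le_sum_abs _ _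
    _ ≤ ∑ b', c₁ * Real.exp (-(δ₁ * σ x b')) * (2 * (Λ + a) * Real.exp (-(r * ρ b' b))) :=
        Finset.sum_le_sum fun b' _ => by
          rw [abs_mul]
          exact mul_le_mul (hKQ x b') (hPinv b') (abs_nonneg _) (by positivity)
    _ = 2 * (Λ + a) * c₁ * ∑ b', Real.exp (-(δ₁ * σ x b')) * Real.exp (-(r * ρ b' b)) := by
        rw [Finset.mul_sum]; exact Finset.sum_congr rfl fun b' _ => by ring
    _ ≤ 2 * (Λ + a) * c₁ * (Kf (m / 2) * Real.exp (-(m / 2 * σ x b))) :=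
        mul_le_mul_of_nonneg_left (sum_exp_mul_exp_le hρ hS hσ0 hσρ hmpos (min_le_left _ _) (min_le_right _ _) x b) (by positivity)
    _ = 2 * (Λ + a) * c₁ * Kf (m / 2) * Real.exp (-(m / 2 * σ x b)) := by ring

end MinOp

/-! ## §4 The two unit-lattice letters from the soft resolvent's fine decay and the block locality of `Q` -/

section Resolvent

variable {ρ : c → c → ℝ} {σ : ν → c → ℝ} {D : ν → ν → ℝ}

omit [Fintype c] [DecidableEq c] in
/-- **`abs_blockProp_le_of_resolvent` — DECAY OF `P = QK⁻¹Qᵀ` FROM DECAY OF `K⁻¹`** [our proof]: `|K⁻¹(x,x′)| ≤ Ce^{−δD(x,x′)}` (`C, δ ≥ 0`), row mass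
`Σ_x|Q(b,x)| ≤ q₁`, and the block compatibility `Q(b,x) ≠ 0 → Q(b′,x′) ≠ 0 → ρ(b,b′) ≤ D(x,x′) + R` ⟹ `|P(b,b′)| ≤ q₁²·C·e^{δR}·e^{−δρ(b,b′)}`. -/
theorem abs_blockProp_le_of_resolvent {K : Matrix ν ν ℝ} {C δ q₁ R : ℝ} (hC : 0 ≤ C) (hδ : 0 ≤ δ)
    (hG : ∀ x x', |K⁻¹ x x'| ≤ C * Real.exp (-(δ * D x x'))) (hq : ∀ b, ∑ x, |Q b x| ≤ q₁)
    (hQρ : ∀ b x b' x', Q b x ≠ 0 → Q b' x' ≠ 0 → ρ b b' ≤ D x x' + R) (b b' : c) :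
    |blockProp K Q b b'| ≤ q₁ ^ 2 * C * Real.exp (δ * R) * Real.exp (-(δ * ρ b b')) := by
  have hq0 : 0 ≤ q₁ := (Finset.sum_nonneg fun x _ => abs_nonneg (Q b x)).trans (hq b)
  -- pointwise: `|Q b x|·|K⁻¹ x x′|·|Q b′ x′| ≤ |Q b x|·|Q b′ x′|·C e^{δR} e^{−δρ(b,b′)}`
  have hpt : ∀ x x', |Q b x * K⁻¹ x x' * Q b' x'| ≤ |Q b x| * |Q b' x'| * (C * Real.exp (δ * R) * Real.exp (-(δ * ρ b b'))) := by
    intro x x'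
    rw [abs_mul, abs_mul]
    by_cases hx : Q b x = 0
    · simp [hx]
    by_cases hx' : Q b' x' = 0
    · simp [hx']
    have hcomp := hQρ b x b' x' hx hx'
    have hexp : Real.exp (-(δ * D x x')) ≤ Real.exp (δ * R) * Real.exp (-(δ * ρ b b')) := by
      rw [← Real.exp_add]; apply Real.exp_le_exp.mpr; nlinarith
    calc |Q b x| * |K⁻¹ x x'| * |Q b' x'| = |Q b x| * |Q b' x'| * |K⁻¹ x x'| := by ring
      _ ≤ |Q b x| * |Q b' x'| * (C * Real.exp (-(δ * D x x'))) := mul_le_mul_of_nonneg_left (hG x x') (by positivity)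
      _ ≤ |Q b x| * |Q b' x'| * (C * (Real.exp (δ * R) * Real.exp (-(δ * ρ b b')))) :=
          mul_le_mul_of_nonneg_left (mul_le_mul_of_nonneg_left hexp hC) (by positivity)
      _ = |Q b x| * |Q b' x'| * (C * Real.exp (δ * R) * Real.exp (-(δ * ρ b b'))) := by ring
  have happly : blockProp K Q b b' = ∑ x', ∑ x, Q b x * K⁻¹ x x' * Q b' x' := by
    rw [blockProp, Matrix.mul_apply]
    refine Finset.sum_congr rfl fun x' _ => ?_
    rw [Matrix.mul_apply, transpose_apply, Finset.sum_mul]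
  rw [happly, Finset.sum_comm]
  calc |∑ x, ∑ x', Q b x * K⁻¹ x x' * Q b' x'|
      ≤ ∑ x, |∑ x', Q b x * K⁻¹ x x' * Q b' x'| := Finset.abs_sum_le_sum_abs _ _
    _ ≤ ∑ x, ∑ x', |Q b x * K⁻¹ x x' * Q b' x'| := Finset.sum_le_sum fun x _ => Finset.abs_sum_le_sum_abs _ _
    _ ≤ ∑ x, ∑ x', |Q b x| * |Q b' x'| * (C * Real.exp (δ * R) * Real.exp (-(δ * ρ b b'))) :=
        Finset.sum_le_sum fun x _ => Finset.sum_le_sum fun x' _ => hpt x x'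
    _ = (∑ x, |Q b x|) * (∑ x', |Q b' x'|) * (C * Real.exp (δ * R) * Real.exp (-(δ * ρ b b'))) := by
        rw [Finset.sum_mul, Finset.sum_mul]
        refine Finset.sum_congr rfl fun x _ => ?_
        rw [Finset.mul_sum, Finset.sum_mul]
    _ ≤ q₁ * q₁ * (C * Real.exp (δ * R) * Real.exp (-(δ * ρ b b'))) := by
        apply mul_le_mul_of_nonneg_right _ (by positivity)
        exact mul_le_mul (hq b) (hq b') (Finset.sum_nonneg fun x _ => abs_nonneg _) hq0
    _ = q₁ ^ 2 * C * Real.exp (δ * R) * Real.exp (-(δ * ρ b b')) := by ring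

omit [Fintype c] [DecidableEq c] in
/-- **`abs_inv_mul_transpose_le_of_resolvent` — DECAY OF `K⁻¹Qᵀ` FROM DECAY OF `K⁻¹`** [our proof]: `|K⁻¹(x,x′)| ≤ Ce^{−δD(x,x′)}` (`C, δ ≥ 0`), row mass
`Σ_x|Q(b,x)| ≤ q₁`, and the fine-to-unit compatibility `Q(b′,x′) ≠ 0 → σ(x,b′) ≤ D(x,x′) + R′` ⟹ `|(K⁻¹Qᵀ)(x,b′)| ≤ q₁·C·e^{δR′}·e^{−δσ(x,b′)}`. -/
theorem abs_inv_mul_transpose_le_of_resolvent {K : Matrix ν ν ℝ} {C δ q₁ R' : ℝ} (hC : 0 ≤ C) (hδ : 0 ≤ δ)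
    (hG : ∀ x x', |K⁻¹ x x'| ≤ C * Real.exp (-(δ * D x x'))) (hq : ∀ b, ∑ x, |Q b x| ≤ q₁)
    (hQσ : ∀ b' x x', Q b' x' ≠ 0 → σ x b' ≤ D x x' + R') (x : ν) (b' : c) :
    |(K⁻¹ * Qᵀ) x b'| ≤ q₁ * C * Real.exp (δ * R') * Real.exp (-(δ * σ x b')) := by
  have hpt : ∀ x', |K⁻¹ x x' * Q b' x'| ≤ |Q b' x'| * (C * Real.exp (δ * R') * Real.exp (-(δ * σ x b'))) := by
    intro x'
    rw [abs_mul]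
    by_cases hx' : Q b' x' = 0
    · simp [hx']
    have hcomp := hQσ b' x x' hx'
    have hexp : Real.exp (-(δ * D x x')) ≤ Real.exp (δ * R') * Real.exp (-(δ * σ x b')) := by
      rw [← Real.exp_add]; apply Real.exp_le_exp.mpr; nlinarith
    calc |K⁻¹ x x'| * |Q b' x'| = |Q b' x'| * |K⁻¹ x x'| := mul_comm _ _
      _ ≤ |Q b' x'| * (C * Real.exp (-(δ * D x x'))) := mul_le_mul_of_nonneg_left (hG x x') (abs_nonneg _)
      _ ≤ |Q b' x'| * (C * (Real.exp (δ * R') * Real.exp (-(δ * σ x b')))) :=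
          mul_le_mul_of_nonneg_left (mul_le_mul_of_nonneg_left hexp hC) (abs_nonneg _)
      _ = |Q b' x'| * (C * Real.exp (δ * R') * Real.exp (-(δ * σ x b'))) := by ring
  rw [Matrix.mul_apply]
  calc |∑ x', K⁻¹ x x' * Qᵀ x' b'| = |∑ x', K⁻¹ x x' * Q b' x'| := by rfl
    _ ≤ ∑ x', |K⁻¹ x x' * Q b' x'| := Finset.abs_sum_le_sum_abs _ _
    _ ≤ ∑ x', |Q b' x'| * (C * Real.exp (δ * R') * Real.exp (-(δ * σ x b'))) := Finset.sum_le_sum fun x' _ => hpt x'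
    _ = (∑ x', |Q b' x'|) * (C * Real.exp (δ * R') * Real.exp (-(δ * σ x b'))) := by rw [Finset.sum_mul]
    _ ≤ q₁ * (C * Real.exp (δ * R') * Real.exp (-(δ * σ x b'))) := mul_le_mul_of_nonneg_right (hq b') (by positivity)
    _ = q₁ * C * Real.exp (δ * R') * Real.exp (-(δ * σ x b')) := by ring

end Resolvent

end Summit.QuantumFields.BalabanUV.Beta.GAN24.EffectiveFormLocalisation

end
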